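import Summits.HodgeConjecture.HodgeConjecture.Theorems.DworkReflectionQuotientsGIOfPrimaryFacts
import Summits.HodgeConjecture.HodgeConjecture.Theorems.DworkReflectionQuotientsK1OfBiniGarbagnati
import Literature.AlgebraicGeometry.HodgeTheory.DworkSexticReflectionQuotientFano

/-!
# Route `DworkReflectionQuotients`: crux K1 and the rung leaf `DworkSexticHodge` from FOUR print-verbatim
# named facts (Bini–Garbagnati 3.20, Kollár–Miyaoka–Mori, Voisin I Thm. 10.3, Voisin II §6.1–6.2)

Route `route-HodgeConjecture-DworkReflectionQuotients` (cell `hodge-nonav`; FRONTIER rung F-H1 — never summit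
credit). Prover seat `hodge-nonav-20241-p1` (g9). SUPPORT FILE (`--supports`; CONDITIONAL results): the whole
route assembled from its residual print dependence, each a refereed theorem specialised to the Dwork sextic in
the tree's vocabulary:
* `DworkSextic.BiniGarbagnati2012_reflectionQuotient_isFano` (B–G Prop. 3.20 verbatim) and
  `Motives.KollarMiyaokaMori1992_fano_rationallyChainConnected` (KMM 1992 Thm. 0.1) ⟹ crux K1
  `ReflectionQuotientDescent` (`reflectionQuotientDescent_of_isFano_of_KMM`, through the landed
  `reflectionQuotientDescent_of_BiniGarbagnati` and `…_smoothProjective_rcc_of_isFano`);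
* `DworkSextic.Griffiths1968_dworkPencil_holomorphicHodgeFrames` (Voisin I Thm. 10.3 along the pencil) and
  `DworkSextic.Voisin2003_dworkPencil_residues_infinitesimal` (Voisin II Cor. 6.12 / Thm. 6.10 / 6.13 + 5.17
  along the pencil) ⟹ crux GI;
* hence the rung leaf `DworkPrymHodge.DworkSexticHodge` — «HC for the very general Dwork sextic fourfold» —
  BY NAME from the four facts (`dworkSexticHodge_of_four_facts`).
Nothing here says HC, HC_CM or HC_AV is proved; rung F-H1 not moved; all four hypotheses are named facts.

## References

* G. Bini, A. Garbagnati, *Quotients of the Dwork pencil*, J. Geom. Phys. 75 (2014), Prop. 3.20.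
  [BiniGarbagnati2012]
* J. Kollár, Y. Miyaoka, S. Mori, J. Differential Geom. 36 (1992), Thm. 0.1. [KollarMiyaokaMori1992]
* C. Voisin, *Hodge Theory I* (2002), Thm. 10.3; *II* (2003), §5.3, §6.1–6.2. [VoisinHodgeI2002]
  [VoisinHodgeII2003]
-/

namespace Summit.HodgeConjecture.HodgeConjecture.Theorems

open Literature.AlgebraicGeometry.HodgeTheory Literature.AlgebraicGeometry.Motives

/-- **Crux K1 `ReflectionQuotientDescent` (stmt-HodgeConjecture-20240) from Bini–Garbagnati Prop. 3.20 verbatim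
and Kollár–Miyaoka–Mori.** CONDITIONAL on the two named facts; rung F-H1 not moved.
[cite: BiniGarbagnati2012, Prop. 3.20] [cite: KollarMiyaokaMori1992, Thm. 0.1] -/
theorem reflectionQuotientDescent_of_isFano_of_KMM
    (hF : DworkSextic.BiniGarbagnati2012_reflectionQuotient_isFano)
    (hK : KollarMiyaokaMori1992_fano_rationallyChainConnected) :
    Summit.HodgeConjecture.HodgeConjecture.Theses.DworkReflectionQuotients.ReflectionQuotientDescent :=
  reflectionQuotientDescent_of_BiniGarbagnati
    (DworkSextic.BiniGarbagnati2012_reflectionQuotient_smoothProjective_rcc_of_isFano hF hK)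

/-- **The rung leaf `DworkSexticHodge` (HC for the very general Dwork sextic fourfold) BY NAME from the four
print-verbatim named facts of the route.** CONDITIONAL; FRONTIER rung F-H1, never summit credit; nothing here
says HC, HC_CM or HC_AV is proved. [cite: BiniGarbagnati2012, Prop. 3.20] [cite: KollarMiyaokaMori1992, Thm. 0.1]
[cite: VoisinHodgeI2002, Thm. 10.3] [cite: VoisinHodgeII2003, Thm. 6.13 and Thm. 6.24 (proof)] -/
theorem dworkSexticHodge_of_four_facts
    (hF : DworkSextic.BiniGarbagnati2012_reflectionQuotient_isFano)
    (hK : KollarMiyaokaMori1992_fano_rationallyChainConnected)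
    (hframes : DworkSextic.Griffiths1968_dworkPencil_holomorphicHodgeFrames)
    (hres : DworkSextic.Voisin2003_dworkPencil_residues_infinitesimal) :
    Summit.HodgeConjecture.HodgeConjecture.Theses.DworkPrymHodge.DworkSexticHodge :=
  dworkSexticHodge_of_reflectionQuotientDescent_of_frames_of_residues
    (reflectionQuotientDescent_of_isFano_of_KMM hF hK) hframes hres

/-- **The support `GenericHodgeClassesFlat` (stmt-HodgeConjecture-20243) BY NAME from the four facts.**
CONDITIONAL; rung F-H1 not moved. [cite: BiniGarbagnati2012, Prop. 3.20] [cite: VoisinHodgeII2003, Thm. 6.24 (proof)] -/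
theorem genericHodgeClassesFlat_of_four_facts
    (hF : DworkSextic.BiniGarbagnati2012_reflectionQuotient_isFano)
    (hK : KollarMiyaokaMori1992_fano_rationallyChainConnected)
    (hframes : DworkSextic.Griffiths1968_dworkPencil_holomorphicHodgeFrames)
    (hres : DworkSextic.Voisin2003_dworkPencil_residues_infinitesimal) :
    Summit.HodgeConjecture.HodgeConjecture.Theses.DworkReflectionQuotients.GenericHodgeClassesFlat :=
  genericHodgeClassesFlat_of_reflectionQuotientDescent_of_frames_of_residues
    (reflectionQuotientDescent_of_isFano_of_KMM hF hK) hframes hres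

end Summit.HodgeConjecture.HodgeConjecture.Theorems
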